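import Mathlib
import Summits.MatrixMultiplication.MatrixMultiplication.Theorems.SnSubsetDichotomyNoThresholdSubsetTriplePairQVTail
import Summits.MatrixMultiplication.MatrixMultiplication.Theorems.SnSubsetDichotomyNoThresholdSubsetTripleFreedmanCompensated
import Summits.MatrixMultiplication.MatrixMultiplication.Theorems.SnSubsetDichotomyNoThresholdSubsetTriplePairDiffEqSumIncr
import Summits.MatrixMultiplication.MatrixMultiplication.Theorems.SnSubsetDichotomyNoThresholdSubsetTripleOneStepBoxBounds
import Summits.MatrixMultiplication.MatrixMultiplication.Theorems.SnSubsetDichotomyNoThresholdSubsetTriplePrefixPairMeasurable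
import Summits.MatrixMultiplication.MatrixMultiplication.Theorems.SnSubsetDichotomyNoThresholdSubsetTripleBoxOfRowLenColLen

/-!
# The Freedman split `J′ ⟸ (L1*) ∧ (M)` (line `klr-graded-polynomial-method`, crux `NoThresholdSubsetTriple`)

Stub `stub_freedmanSplit` of skeleton v14 (lead c8), crux `SnSubsetDichotomy.NoThresholdSubsetTriple`
(stmt-MatrixMultiplication-8302).  The moderate deviation J′ of the parity-signed SW/NE pair count `J(T)` of the second
tableau of a uniform same-shape pair (the open stub of skeletons v6–v13) follows from the drift hypothesis (L1\*)
`PlancherelStep.DriftHypothesis` and the compensator large deviation (M).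

Proof (lead c4 report §3e made formal).  On the uniform space `pairMeasure n` with the prefix filtration `ℱ`, put
`Z_t := Σ_{z ∈ ν_{t+1} ∖ ν_t} [ν_t boxed]·π_z·x_z(ν_t)` (`ν_t = shapeBefore`, `π = (−1)^{row+col}`, `x = incr`): on a boxed
pair `Σ_{t<n} Z_t = J(T)` (increment identity `pairDiff_eq_sum_incr`), `|Z_t| ≤ 8√n` (`oneStep_box_bounds`), and by the model
theorem `condExp_prefix_succ_param`, `μ[Z_t | ℱ_t] = [boxed]·m(ν_t)` and `μ[Z_t² | ℱ_t] = [boxed]·sqEnergy(ν_t)` a.e.  Hence,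
off a null set, `{boxed ∧ 200 J ≤ −n} ⊆ {Σ(Z − μ[Z|ℱ]) ≤ −n/400 ∧ Σ μ[Z²|ℱ] ≤ A n√n} ∪ {boxed ∧ A n√n ≤ Σ_t sqEnergy ν_t} ∪
{boxed ∧ 400 Σ_t m(ν_t) ≤ −n}`; the first is `≤ e^{−√n/(640000 A)}` by `freedman_compensated_lowerTail` with `λ = 1/(800 A √n)`,
the second `≤ 2e^{−κA√n}` by `pairQV_tail_of_drift` (the (Q) half modulo (L1\*)), the third `≤ e^{−c_M √n}` by (M).
-/

open MeasureTheory ProbabilityTheory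
open scoped BigOperators ENNReal
open Literature.RepresentationTheory.FiniteGroups (addableNodes IsAddableNode mem_addableNodes TableauPair)
open Literature.NumberTheory.DiophantineGeometry (StdFilling)

namespace Summit.MatrixMultiplication.MatrixMultiplication.Theorems

open PlancherelStep PlancherelGrowth

set_option linter.dupNamespace false in
/-- Real-valued monotonicity of a finite measure along an a.e. inclusion. [folklore] -/
private theorem fs_measureReal_mono_ae {Ω : Type*} [MeasurableSpace Ω] {μ : Measure Ω}
    [IsFiniteMeasure μ] {s t : Set Ω} (h : ∀ᵐ ω ∂μ, ω ∈ s → ω ∈ t) : μ.real s ≤ μ.real t := by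
  simp only [measureReal_def]
  exact ENNReal.toReal_mono (measure_ne_top _ _) (measure_mono_ae h)

-- adapted from the private lemma `shapeBefore_succ_of_le` of
-- Summits/MatrixMultiplication/MatrixMultiplication/Theorems/SnSubsetDichotomyNoThresholdSubsetTriplePairQVTail.lean
set_option linter.dupNamespace false in
/-- After time `n` the growth is over: `shapeBefore f (t+1) = shapeBefore f t` for `n ≤ t`. [folklore] -/
private theorem fs_shapeBefore_succ_of_le {n : ℕ} (f : Fin n → ℕ × ℕ) {t : ℕ} (ht : n ≤ t) :
    shapeBefore f (t + 1) = shapeBefore f t := by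
  unfold shapeBefore
  congr 1
  ext j
  simp only [Finset.mem_filter, Finset.mem_univ, true_and]
  exact ⟨fun _ => lt_of_lt_of_le j.2 ht, fun h => Nat.lt_succ_of_lt h⟩

-- adapted from the private lemma `shapeBefore_subset_cells` of the same file
set_option linter.dupNamespace false in
/-- Every prefix shape of the second tableau is a subset of the common shape of the pair. [folklore] -/
private theorem fs_shapeBefore_subset_cells {n : ℕ} (ω : TableauPair n) (t : ℕ) {x : ℕ × ℕ}
    (hx : x ∈ shapeBefore (ω.2.2).1 t) : x ∈ ω.1.youngDiagram.cells := by
  simp only [shapeBefore, Finset.mem_image, Finset.mem_filter, Finset.mem_univ, true_and] at hx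
  obtain ⟨j, _, rfl⟩ := hx
  exact (YoungDiagram.mem_cells _).2 ((ω.2.2).mem j)

set_option linter.dupNamespace false in
/-- An addable node is not a cell. [folklore] -/
private theorem fs_not_mem_of_mem_addableNodes {Y : Finset (ℕ × ℕ)} {z : ℕ × ℕ} (hz : z ∈ addableNodes Y) :
    z ∉ Y := (mem_addableNodes.1 hz).1

set_option linter.dupNamespace false in
/-- `insert z Y ∖ Y = {z}` for `z ∉ Y`. [folklore] -/
private theorem fs_insert_sdiff_self {Y : Finset (ℕ × ℕ)} {z : ℕ × ℕ} (hz : z ∉ Y) :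
    insert z Y \ Y = {z} := by
  rw [Finset.insert_sdiff_of_notMem _ hz, Finset.sdiff_self]
  rfl

set_option linter.dupNamespace false in
/-- `((−1)^k · x)² = x²`. [folklore] -/
private theorem fs_neg_one_pow_mul_sq (k : ℕ) (x : ℝ) : ((-1 : ℝ) ^ k * x) ^ 2 = x ^ 2 := by
  rw [mul_pow, ← pow_mul, mul_comm k 2, pow_mul, neg_one_sq, one_pow, one_mul]

set_option linter.dupNamespace false in
/-- Drift: `Σ_z p_z · hZ(Y, Y ∪ z) = [Y boxed]·m(Y)`. [folklore] -/
private theorem fs_kernel_hZ (n : ℕ) (Y : Finset (ℕ × ℕ)) :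
    ∑ z ∈ addableNodes Y, transProb Y z *
        (∑ z' ∈ insert z Y \ Y, (if (∀ x ∈ Y, (x.1 : ℝ) < 3 * Real.sqrt n ∧ (x.2 : ℝ) < 3 * Real.sqrt n) then (-1 : ℝ) ^ (z'.1 + z'.2) * (incr Y z' : ℝ) else 0)) =
      if (∀ x ∈ Y, (x.1 : ℝ) < 3 * Real.sqrt n ∧ (x.2 : ℝ) < 3 * Real.sqrt n)
        then ∑ z ∈ addableNodes Y, transProb Y z * ((-1 : ℝ) ^ (z.1 + z.2) * (incr Y z : ℝ)) else 0 := by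
  have h : ∀ z ∈ addableNodes Y, transProb Y z *
      (∑ z' ∈ insert z Y \ Y, (if (∀ x ∈ Y, (x.1 : ℝ) < 3 * Real.sqrt n ∧ (x.2 : ℝ) < 3 * Real.sqrt n) then (-1 : ℝ) ^ (z'.1 + z'.2) * (incr Y z' : ℝ) else 0)) =
      transProb Y z * (if (∀ x ∈ Y, (x.1 : ℝ) < 3 * Real.sqrt n ∧ (x.2 : ℝ) < 3 * Real.sqrt n) then (-1 : ℝ) ^ (z.1 + z.2) * (incr Y z : ℝ) else 0) := fun z hz => by
    rw [fs_insert_sdiff_self (fs_not_mem_of_mem_addableNodes hz), Finset.sum_singleton]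
  rw [Finset.sum_congr rfl h]
  split_ifs
  · rfl
  · simp only [mul_zero, Finset.sum_const_zero]

set_option linter.dupNamespace false in
/-- Second moment: `Σ_z p_z · hZ(Y, Y ∪ z)² = [Y boxed]·sqEnergy(Y)`. [folklore] -/
private theorem fs_kernel_hZ_sq (n : ℕ) (Y : Finset (ℕ × ℕ)) :
    ∑ z ∈ addableNodes Y, transProb Y z *
        (∑ z' ∈ insert z Y \ Y, (if (∀ x ∈ Y, (x.1 : ℝ) < 3 * Real.sqrt n ∧ (x.2 : ℝ) < 3 * Real.sqrt n) then (-1 : ℝ) ^ (z'.1 + z'.2) * (incr Y z' : ℝ) else 0)) ^ 2 =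
      if (∀ x ∈ Y, (x.1 : ℝ) < 3 * Real.sqrt n ∧ (x.2 : ℝ) < 3 * Real.sqrt n) then sqEnergy Y else 0 := by
  have h : ∀ z ∈ addableNodes Y, transProb Y z *
      (∑ z' ∈ insert z Y \ Y, (if (∀ x ∈ Y, (x.1 : ℝ) < 3 * Real.sqrt n ∧ (x.2 : ℝ) < 3 * Real.sqrt n) then (-1 : ℝ) ^ (z'.1 + z'.2) * (incr Y z' : ℝ) else 0)) ^ 2 =
      transProb Y z * (if (∀ x ∈ Y, (x.1 : ℝ) < 3 * Real.sqrt n ∧ (x.2 : ℝ) < 3 * Real.sqrt n) then (incr Y z : ℝ) ^ 2 else 0) := fun z hz => by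
    rw [fs_insert_sdiff_self (fs_not_mem_of_mem_addableNodes hz), Finset.sum_singleton]
    split_ifs
    · rw [fs_neg_one_pow_mul_sq]
    · rw [sq, mul_zero]
  rw [Finset.sum_congr rfl h]
  split_ifs
  · rfl
  · simp only [mul_zero, Finset.sum_const_zero]

set_option linter.dupNamespace false in
/-- Bounded increments: `|Z_t| ≤ 8√n` (for `t < n` the new cells are the single addable node `T t`, and `|π·x| = |x| ≤ 8√n`
on the box — the bound `hinc`, tree `oneStep_box_bounds`; for `t ≥ n` there is no new cell). [folklore] -/
private theorem fs_abs_Z_le {n : ℕ} (hinc : ∀ Y : Finset (ℕ × ℕ), IsLowerSet (Y : Set (ℕ × ℕ)) →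
      (∀ x ∈ Y, (x.1 : ℝ) < 3 * Real.sqrt n ∧ (x.2 : ℝ) < 3 * Real.sqrt n) →
        ∀ z : ℕ × ℕ, |((incr Y z : ℤ) : ℝ)| ≤ 8 * Real.sqrt n)
    (t : ℕ) (ω : TableauPair n) :
    |∑ z' ∈ shapeBefore (ω.2.2).1 (t + 1) \ shapeBefore (ω.2.2).1 t, (if (∀ x ∈ shapeBefore (ω.2.2).1 t, (x.1 : ℝ) < 3 * Real.sqrt n ∧ (x.2 : ℝ) < 3 * Real.sqrt n) then (-1 : ℝ) ^ (z'.1 + z'.2) * (incr (shapeBefore (ω.2.2).1 t) z' : ℝ) else 0)| ≤ 8 * Real.sqrt n := by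
  have h8 : (0 : ℝ) ≤ 8 * Real.sqrt n := by positivity
  by_cases ht : t < n
  · have hA := shapeBefore_api n _ ω.2.2 ω.1.card_cells_youngDiagram
    rw [hA.2.1 t ht, fs_insert_sdiff_self (fs_not_mem_of_mem_addableNodes (hA.2.2.2.2 t ht)),
      Finset.sum_singleton]
    split_ifs with hbx
    · rw [abs_mul, abs_pow, abs_neg, abs_one, one_pow, one_mul]
      exact hinc _ (hA.2.2.2.1 t) hbx _
    · rw [abs_zero]
      exact h8
  · rw [fs_shapeBefore_succ_of_le _ (not_lt.1 ht), Finset.sdiff_self, Finset.sum_empty, abs_zero]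
    exact h8

set_option linter.dupNamespace false in
/-- The path identity: on a pair whose shape lies in the box, `Σ_{t<n} Z_t = J(T)` (increment identity
`pairDiff_eq_sum_incr`, every prefix shape being boxed). [folklore] -/
private theorem fs_sum_Z_eq {n : ℕ} (ω : TableauPair n)
    (hbox : ∀ x ∈ ω.1.youngDiagram.cells, (x.1 : ℝ) < 3 * Real.sqrt n ∧ (x.2 : ℝ) < 3 * Real.sqrt n) :
    ∑ t ∈ Finset.range n, ∑ z' ∈ shapeBefore (ω.2.2).1 (t + 1) \ shapeBefore (ω.2.2).1 t, (if (∀ x ∈ shapeBefore (ω.2.2).1 t, (x.1 : ℝ) < 3 * Real.sqrt n ∧ (x.2 : ℝ) < 3 * Real.sqrt n) then (-1 : ℝ) ^ (z'.1 + z'.2) * (incr (shapeBefore (ω.2.2).1 t) z' : ℝ) else 0) =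
      (((∑ k : Fin n, ∑ j ∈ Finset.univ.filter
          (fun j : Fin n => j < k ∧ ((ω.2.2).1 k).1 < ((ω.2.2).1 j).1 ∧ ((ω.2.2).1 j).2 < ((ω.2.2).1 k).2),
          (-1 : ℤ) ^ (((ω.2.2).1 j).1 + ((ω.2.2).1 j).2 + ((ω.2.2).1 k).1 + ((ω.2.2).1 k).2)) -
        (∑ k : Fin n, ∑ j ∈ Finset.univ.filter
          (fun j : Fin n => j < k ∧ ((ω.2.2).1 j).1 < ((ω.2.2).1 k).1 ∧ ((ω.2.2).1 k).2 < ((ω.2.2).1 j).2),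
          (-1 : ℤ) ^ (((ω.2.2).1 j).1 + ((ω.2.2).1 j).2 + ((ω.2.2).1 k).1 + ((ω.2.2).1 k).2)) : ℤ) : ℝ) := by
  have hA := shapeBefore_api n _ ω.2.2 ω.1.card_cells_youngDiagram
  rw [pairDiff_eq_sum_incr n ω.1 ω.2.2, Int.cast_sum,
    ← Fin.sum_univ_eq_sum_range (fun t => ∑ z' ∈ shapeBefore (ω.2.2).1 (t + 1) \ shapeBefore (ω.2.2).1 t, (if (∀ x ∈ shapeBefore (ω.2.2).1 t, (x.1 : ℝ) < 3 * Real.sqrt n ∧ (x.2 : ℝ) < 3 * Real.sqrt n) then (-1 : ℝ) ^ (z'.1 + z'.2) * (incr (shapeBefore (ω.2.2).1 t) z' : ℝ) else 0)) n]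
  refine Finset.sum_congr rfl fun k _ => ?_
  have hbk : ∀ x ∈ shapeBefore (ω.2.2).1 k, (x.1 : ℝ) < 3 * Real.sqrt n ∧ (x.2 : ℝ) < 3 * Real.sqrt n :=
    fun x hx => hbox x (fs_shapeBefore_subset_cells ω k hx)
  rw [hA.2.1 k k.2, fs_insert_sdiff_self (fs_not_mem_of_mem_addableNodes (hA.2.2.2.2 k k.2)),
    Finset.sum_singleton, if_pos hbk]
  push_cast
  rfl

set_option linter.dupNamespace false in
/-- The Freedman exponent with `B = 8√n`, `x = n/400`, `v = A·n·√n`, `λ = 1/(800 A √n)`: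
`−λx + v·(e^{2λB} − 1 − 2λB)/(2B)² ≤ −√n/(640000 A)` (`2λB = 1/(50A) ≤ 1`, `e^u − 1 − u ≤ u²`). [folklore] -/
private theorem fs_freedman_exponent {n : ℕ} (hn : 1 ≤ n) {A : ℝ} (hA : 1 ≤ A) :
    -((1 / (800 * A) / Real.sqrt n) * (n / 400)) + A * n * Real.sqrt n *
        ((Real.exp ((1 / (800 * A) / Real.sqrt n) * (2 * (8 * Real.sqrt n))) - 1 -
          (1 / (800 * A) / Real.sqrt n) * (2 * (8 * Real.sqrt n))) / (2 * (8 * Real.sqrt n)) ^ 2) ≤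
      -(1 / (640000 * A) * Real.sqrt n) := by
  set s : ℝ := Real.sqrt n with hs
  have hs0 : 0 < s := Real.sqrt_pos.2 (by exact_mod_cast hn)
  have hA0 : 0 < A := by linarith
  have hsq : s ^ 2 = n := by rw [hs]; exact Real.sq_sqrt (Nat.cast_nonneg n)
  have hu : (1 / (800 * A) / s) * (2 * (8 * s)) = 1 / (50 * A) := by
    field_simp
    ring
  have hu1 : |1 / (50 * A)| ≤ 1 := by
    rw [abs_of_pos (by positivity), div_le_one (by positivity)]
    linarith
  have hexp : Real.exp (1 / (50 * A)) - 1 - 1 / (50 * A) ≤ (1 / (50 * A)) ^ 2 :=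
    (le_abs_self _).trans (Real.abs_exp_sub_one_sub_id_le hu1)
  rw [hu, ← hsq]
  have h1 : (1 / (800 * A) / s) * (s ^ 2 / 400) = s / (320000 * A) := by
    field_simp
    ring
  have h2 : A * s ^ 2 * s * ((Real.exp (1 / (50 * A)) - 1 - 1 / (50 * A)) / (2 * (8 * s)) ^ 2) ≤
      s / (640000 * A) := by
    calc A * s ^ 2 * s * ((Real.exp (1 / (50 * A)) - 1 - 1 / (50 * A)) / (2 * (8 * s)) ^ 2)
        ≤ A * s ^ 2 * s * ((1 / (50 * A)) ^ 2 / (2 * (8 * s)) ^ 2) :=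
          mul_le_mul_of_nonneg_left (div_le_div_of_nonneg_right hexp (by positivity)) (by positivity)
      _ = s / (640000 * A) := by
          field_simp
          ring
  have h3 : s / (320000 * A) = 2 * (s / (640000 * A)) := by
    field_simp
    ring
  have h4 : 1 / (640000 * A) * s = s / (640000 * A) := by
    field_simp
  rw [h1, h3, h4]
  linarith

set_option linter.dupNamespace false in
/-- `4·e^{−c√n} ≤ e^{−(c/2)√n}` once `16/c² ≤ n` (then `(c/2)√n ≥ 2` and `e² ≥ 5`). [folklore] -/
private theorem fs_four_exp_le {c : ℝ} (hc : 0 < c) {n : ℕ} (hn : ⌈16 / c ^ 2⌉₊ ≤ n) :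
    4 * Real.exp (-(c * Real.sqrt n)) ≤ Real.exp (-(c / 2 * Real.sqrt n)) := by
  have hn' : 16 / c ^ 2 ≤ (n : ℝ) := (Nat.le_ceil _).trans (by exact_mod_cast hn)
  have hsq : 4 / c ≤ Real.sqrt n := by
    rw [show (4 : ℝ) / c = Real.sqrt ((4 / c) ^ 2) by rw [Real.sqrt_sq (by positivity)]]
    exact Real.sqrt_le_sqrt (by rw [div_pow]; norm_num; exact hn')
  have h2 : 2 ≤ c / 2 * Real.sqrt n := by
    have := mul_le_mul_of_nonneg_left hsq (show (0 : ℝ) ≤ c / 2 by positivity)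
    rw [show c / 2 * (4 / c) = 2 by field_simp; ring] at this
    exact this
  have h5 : (4 : ℝ) ≤ Real.exp (c / 2 * Real.sqrt n) := by
    have hq := Real.quadratic_le_exp_of_nonneg (show (0 : ℝ) ≤ c / 2 * Real.sqrt n by positivity)
    nlinarith
  have hsplit : Real.exp (-(c * Real.sqrt n)) = Real.exp (-(c / 2 * Real.sqrt n)) * (Real.exp (c / 2 * Real.sqrt n))⁻¹ := by
    rw [← Real.exp_neg, ← Real.exp_add]
    congr 1
    ring
  rw [hsplit]
  have hpos : 0 < Real.exp (-(c / 2 * Real.sqrt n)) := Real.exp_pos _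
  have hinv : 4 * (Real.exp (c / 2 * Real.sqrt n))⁻¹ ≤ 1 := by
    rw [mul_inv_le_iff₀ (Real.exp_pos _), one_mul]
    exact h5
  nlinarith [mul_le_mul_of_nonneg_left hinv hpos.le]

set_option linter.dupNamespace false in
/-- Off a null set: for every `t < n`, `μ[Z_t | ℱ_t] = [ν_t boxed]·m(ν_t)` and `μ[Z_t² | ℱ_t] = [ν_t boxed]·sqEnergy(ν_t)`
(the Markov property `condExp_prefix_succ_param` + the kernel identities `fs_kernel_hZ`, `fs_kernel_hZ_sq`). [folklore] -/
private theorem fs_condExp_ae (n : ℕ) :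
    ∀ᵐ ω ∂(pairMeasure n), ∀ t : ℕ, t < n →
      ((pairMeasure n)[fun ω => ∑ z' ∈ shapeBefore (ω.2.2).1 (t + 1) \ shapeBefore (ω.2.2).1 t, (if (∀ x ∈ shapeBefore (ω.2.2).1 t, (x.1 : ℝ) < 3 * Real.sqrt n ∧ (x.2 : ℝ) < 3 * Real.sqrt n) then (-1 : ℝ) ^ (z'.1 + z'.2) * (incr (shapeBefore (ω.2.2).1 t) z' : ℝ) else 0) | prefixFiltration n t]) ω =
        (if (∀ x ∈ shapeBefore (ω.2.2).1 t, (x.1 : ℝ) < 3 * Real.sqrt n ∧ (x.2 : ℝ) < 3 * Real.sqrt n) then ∑ z ∈ addableNodes (shapeBefore (ω.2.2).1 t), transProb (shapeBefore (ω.2.2).1 t) z * ((-1 : ℝ) ^ (z.1 + z.2) * (incr (shapeBefore (ω.2.2).1 t) z : ℝ)) else 0) ∧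
      ((pairMeasure n)[fun ω => (∑ z' ∈ shapeBefore (ω.2.2).1 (t + 1) \ shapeBefore (ω.2.2).1 t, (if (∀ x ∈ shapeBefore (ω.2.2).1 t, (x.1 : ℝ) < 3 * Real.sqrt n ∧ (x.2 : ℝ) < 3 * Real.sqrt n) then (-1 : ℝ) ^ (z'.1 + z'.2) * (incr (shapeBefore (ω.2.2).1 t) z' : ℝ) else 0)) ^ 2 | prefixFiltration n t]) ω =
        (if (∀ x ∈ shapeBefore (ω.2.2).1 t, (x.1 : ℝ) < 3 * Real.sqrt n ∧ (x.2 : ℝ) < 3 * Real.sqrt n) then sqEnergy (shapeBefore (ω.2.2).1 t) else 0) := by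
  rw [ae_all_iff]
  intro t
  by_cases ht : t < n
  · have h1 := condExp_prefix_succ_param n t ht fun Y Y' : Finset (ℕ × ℕ) => ∑ z' ∈ Y' \ Y, (if (∀ x ∈ Y, (x.1 : ℝ) < 3 * Real.sqrt n ∧ (x.2 : ℝ) < 3 * Real.sqrt n) then (-1 : ℝ) ^ (z'.1 + z'.2) * (incr Y z' : ℝ) else 0)
    have h2 := condExp_prefix_succ_param n t ht fun Y Y' : Finset (ℕ × ℕ) => (∑ z' ∈ Y' \ Y, (if (∀ x ∈ Y, (x.1 : ℝ) < 3 * Real.sqrt n ∧ (x.2 : ℝ) < 3 * Real.sqrt n) then (-1 : ℝ) ^ (z'.1 + z'.2) * (incr Y z' : ℝ) else 0)) ^ 2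
    filter_upwards [h1, h2] with ω hω1 hω2
    intro _
    exact ⟨hω1.trans (fs_kernel_hZ n _), hω2.trans (fs_kernel_hZ_sq n _)⟩
  · exact Filter.Eventually.of_forall fun ω h => absurd h ht

set_option linter.dupNamespace false in
/-- **The Freedman split `J′ ⟸ (L1\*) ∧ (M)`** (stub `stub_freedmanSplit` of line `klr-graded-polynomial-method`, skeleton
v14, crux `SnSubsetDichotomy.NoThresholdSubsetTriple`).  If the drift hypothesis `PlancherelStep.DriftHypothesis` holds and the
compensator `Σ_{t<n} m(ν_t)`, `m(ν) = Σ_z transProb ν z · (−1)^{row z + col z} · incr ν z`, of the Plancherel growth of a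
uniform same-shape pair has the lower large deviation `#{boxed, 400·Σ m ≤ −n} ≤ n!·e^{−c√n}`, then the parity-signed SW/NE
pair count `J(T)` of the second tableau has the moderate deviation `#{μ₁, ℓ(μ) < 3√n, 200·J ≤ −n} ≤ n!·e^{−c′√n}` (J′).
Proof: martingale + compensator decomposition of `J = Σ_t Z_t` along the prefix filtration; Freedman's inequality
(`freedman_compensated_lowerTail`, increments `≤ 8√n`, `λ = 1/(800A√n)`) for the martingale part on
`{⟨M⟩ ≤ Σ_t sqEnergy ν_t ≤ A n√n}`, the (Q) half `pairQV_tail_of_drift` for `{Σ_t sqEnergy ν_t ≥ A n√n}`, and (M).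
[lead c4 report §3e; Freedman 1975, Thm. 1.6] -/
theorem stub_freedmanSplit : PlancherelStep.DriftHypothesis →
    (∃ c : ℝ, 0 < c ∧ ∃ n₀ : ℕ, ∀ n ≥ n₀, (Nat.card {ω : TableauPair n //
      (∀ x ∈ ω.1.youngDiagram.cells, (x.1 : ℝ) < 3 * Real.sqrt n ∧ (x.2 : ℝ) < 3 * Real.sqrt n) ∧
      400 * (∑ t ∈ Finset.range n, ∑ z ∈ addableNodes (shapeBefore (ω.2.2).1 t),
        transProb (shapeBefore (ω.2.2).1 t) z * ((-1 : ℝ) ^ (z.1 + z.2) * (incr (shapeBefore (ω.2.2).1 t) z : ℝ))) ≤ -(n : ℝ)} : ℝ) ≤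
      (n.factorial : ℝ) * Real.exp (-(c * Real.sqrt (n : ℝ)))) →
    ∃ c : ℝ, 0 < c ∧ ∃ n₀ : ℕ, ∀ n ≥ n₀, (Nat.card {i : TableauPair n // (i.1.youngDiagram.rowLen 0 : ℝ) < 3 *
      Real.sqrt (n : ℝ) ∧ (i.1.youngDiagram.colLen 0 : ℝ) < 3 * Real.sqrt (n : ℝ) ∧ 200 * ((∑ k : Fin n, ∑ j ∈
      Finset.univ.filter (fun j : Fin n => j < k ∧ (i.2.2.1 k).1 < (i.2.2.1 j).1 ∧ (i.2.2.1 j).2 < (i.2.2.1 k).2), (-1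
      : ℤ) ^ ((i.2.2.1 j).1 + (i.2.2.1 j).2 + (i.2.2.1 k).1 + (i.2.2.1 k).2)) - (∑ k : Fin n, ∑ j ∈ Finset.univ.filter
      (fun j : Fin n => j < k ∧ (i.2.2.1 j).1 < (i.2.2.1 k).1 ∧ (i.2.2.1 k).2 < (i.2.2.1 j).2), (-1 : ℤ) ^ ((i.2.2.1
      j).1 + (i.2.2.1 j).2 + (i.2.2.1 k).1 + (i.2.2.1 k).2))) ≤ -(n : ℤ)} : ℝ) ≤ (n.factorial : ℝ) * Real.exp (-(c *
      Real.sqrt (n : ℝ))) := by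
  intro hdrift hM
  obtain ⟨κ, hκ, A₀, hQ⟩ := pairQV_tail_of_drift hdrift
  obtain ⟨cM, hcM, n₀, hMn⟩ := hM
  -- constants
  set A : ℝ := max A₀ 1 with hA_def
  have hA1 : 1 ≤ A := le_max_right _ _
  have hA0 : A₀ ≤ A := le_max_left _ _
  have hApos : 0 < A := by linarith
  set c' : ℝ := min (1 / (640000 * A)) (min (κ * A) cM) with hc'_def
  have hc' : 0 < c' := lt_min (by positivity) (lt_min (by positivity) hcM)
  have hc1 : c' ≤ 1 / (640000 * A) := min_le_left _ _
  have hc2 : c' ≤ κ * A := (min_le_right _ _).trans (min_le_left _ _)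
  have hc3 : c' ≤ cM := (min_le_right _ _).trans (min_le_right _ _)
  refine ⟨c' / 2, by positivity, max n₀ (max 1 ⌈16 / c' ^ 2⌉₊), ?_⟩
  intro n hn
  have hn₀ : n₀ ≤ n := le_trans (le_max_left _ _) hn
  have hn1 : 1 ≤ n := le_trans (le_trans (le_max_left _ _) (le_max_right _ _)) hn
  have hn16 : ⌈16 / c' ^ 2⌉₊ ≤ n := le_trans (le_trans (le_max_right _ _) (le_max_right _ _)) hn
  have hs0 : 0 < Real.sqrt n := Real.sqrt_pos.2 (by exact_mod_cast hn1)
  have hB8 : 0 < 8 * Real.sqrt n := by positivity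
  have hfac : (0 : ℝ) < n.factorial := by exact_mod_cast Nat.factorial_pos n
  -- the probability space
  have hbasic := pairMeasure_basic n
  haveI : IsProbabilityMeasure (pairMeasure n) := hbasic.1
  -- (1) the martingale part: Freedman for the compensated increments
  have hinc : ∀ Y : Finset (ℕ × ℕ), IsLowerSet (Y : Set (ℕ × ℕ)) →
      (∀ x ∈ Y, (x.1 : ℝ) < 3 * Real.sqrt n ∧ (x.2 : ℝ) < 3 * Real.sqrt n) →
        ∀ z : ℕ × ℕ, |((incr Y z : ℤ) : ℝ)| ≤ 8 * Real.sqrt n :=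
    fun Y hY hbx => (oneStep_box_bounds n hn1 Y hY hbx).1
  have hE1 : (pairMeasure n).real {ω | ∑ t ∈ Finset.range n,
        ((∑ z' ∈ shapeBefore (ω.2.2).1 (t + 1) \ shapeBefore (ω.2.2).1 t, (if (∀ x ∈ shapeBefore (ω.2.2).1 t, (x.1 : ℝ) < 3 * Real.sqrt n ∧ (x.2 : ℝ) < 3 * Real.sqrt n) then (-1 : ℝ) ^ (z'.1 + z'.2) * (incr (shapeBefore (ω.2.2).1 t) z' : ℝ) else 0)) -
        ((pairMeasure n)[fun ω => ∑ z' ∈ shapeBefore (ω.2.2).1 (t + 1) \ shapeBefore (ω.2.2).1 t, (if (∀ x ∈ shapeBefore (ω.2.2).1 t, (x.1 : ℝ) < 3 * Real.sqrt n ∧ (x.2 : ℝ) < 3 * Real.sqrt n) then (-1 : ℝ) ^ (z'.1 + z'.2) * (incr (shapeBefore (ω.2.2).1 t) z' : ℝ) else 0) | prefixFiltration n t]) ω) ≤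
          -((n : ℝ) / 400) ∧
        ∑ t ∈ Finset.range n, ((pairMeasure n)[fun ω' => (∑ z' ∈ shapeBefore (ω'.2.2).1 (t + 1) \ shapeBefore (ω'.2.2).1 t,
          (if (∀ x ∈ shapeBefore (ω'.2.2).1 t, (x.1 : ℝ) < 3 * Real.sqrt n ∧ (x.2 : ℝ) < 3 * Real.sqrt n) then (-1 : ℝ) ^ (z'.1 + z'.2) * (incr (shapeBefore (ω'.2.2).1 t) z' : ℝ) else 0)) ^ 2 | prefixFiltration n t]) ω ≤
          A * n * Real.sqrt n} ≤ Real.exp (-(1 / (640000 * A) * Real.sqrt n)) :=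
    (freedman_compensated_lowerTail (μ := pairMeasure n) (prefixFiltration n)
      (fun t ω => ∑ z' ∈ shapeBefore (ω.2.2).1 (t + 1) \ shapeBefore (ω.2.2).1 t, (if (∀ x ∈ shapeBefore (ω.2.2).1 t, (x.1 : ℝ) < 3 * Real.sqrt n ∧ (x.2 : ℝ) < 3 * Real.sqrt n) then (-1 : ℝ) ^ (z'.1 + z'.2) * (incr (shapeBefore (ω.2.2).1 t) z' : ℝ) else 0))
      (8 * Real.sqrt n) hB8
      (fun t => stronglyMeasurable_prefix_pair n t fun Y Y' : Finset (ℕ × ℕ) => ∑ z' ∈ Y' \ Y, (if (∀ x ∈ Y, (x.1 : ℝ) < 3 * Real.sqrt n ∧ (x.2 : ℝ) < 3 * Real.sqrt n) then (-1 : ℝ) ^ (z'.1 + z'.2) * (incr Y z' : ℝ) else 0))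
      (fun t ω => fs_abs_Z_le hinc t ω) n ((n : ℝ) / 400) (A * n * Real.sqrt n)
      (1 / (800 * A) / Real.sqrt n) (by positivity)).trans
      (Real.exp_le_exp.2 (fs_freedman_exponent hn1 hA1))
  -- (2) the a.e. identification of the compensator and the quadratic variation, and the event inclusion
  have hincl : ∀ᵐ ω ∂(pairMeasure n),
      ω ∈ {i : TableauPair n | (i.1.youngDiagram.rowLen 0 : ℝ) < 3 * Real.sqrt (n : ℝ) ∧
        (i.1.youngDiagram.colLen 0 : ℝ) < 3 * Real.sqrt (n : ℝ) ∧ 200 * ((∑ k : Fin n, ∑ j ∈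
        Finset.univ.filter (fun j : Fin n => j < k ∧ (i.2.2.1 k).1 < (i.2.2.1 j).1 ∧ (i.2.2.1 j).2 < (i.2.2.1 k).2), (-1
        : ℤ) ^ ((i.2.2.1 j).1 + (i.2.2.1 j).2 + (i.2.2.1 k).1 + (i.2.2.1 k).2)) - (∑ k : Fin n, ∑ j ∈ Finset.univ.filter
        (fun j : Fin n => j < k ∧ (i.2.2.1 j).1 < (i.2.2.1 k).1 ∧ (i.2.2.1 k).2 < (i.2.2.1 j).2), (-1 : ℤ) ^ ((i.2.2.1
        j).1 + (i.2.2.1 j).2 + (i.2.2.1 k).1 + (i.2.2.1 k).2))) ≤ -(n : ℤ)} →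
      ω ∈ {ω : TableauPair n | ∑ t ∈ Finset.range n,
        ((∑ z' ∈ shapeBefore (ω.2.2).1 (t + 1) \ shapeBefore (ω.2.2).1 t, (if (∀ x ∈ shapeBefore (ω.2.2).1 t, (x.1 : ℝ) < 3 * Real.sqrt n ∧ (x.2 : ℝ) < 3 * Real.sqrt n) then (-1 : ℝ) ^ (z'.1 + z'.2) * (incr (shapeBefore (ω.2.2).1 t) z' : ℝ) else 0)) -
        ((pairMeasure n)[fun ω => ∑ z' ∈ shapeBefore (ω.2.2).1 (t + 1) \ shapeBefore (ω.2.2).1 t, (if (∀ x ∈ shapeBefore (ω.2.2).1 t, (x.1 : ℝ) < 3 * Real.sqrt n ∧ (x.2 : ℝ) < 3 * Real.sqrt n) then (-1 : ℝ) ^ (z'.1 + z'.2) * (incr (shapeBefore (ω.2.2).1 t) z' : ℝ) else 0) | prefixFiltration n t]) ω) ≤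
          -((n : ℝ) / 400) ∧
        ∑ t ∈ Finset.range n, ((pairMeasure n)[fun ω' => (∑ z' ∈ shapeBefore (ω'.2.2).1 (t + 1) \ shapeBefore (ω'.2.2).1 t,
          (if (∀ x ∈ shapeBefore (ω'.2.2).1 t, (x.1 : ℝ) < 3 * Real.sqrt n ∧ (x.2 : ℝ) < 3 * Real.sqrt n) then (-1 : ℝ) ^ (z'.1 + z'.2) * (incr (shapeBefore (ω'.2.2).1 t) z' : ℝ) else 0)) ^ 2 | prefixFiltration n t]) ω ≤
          A * n * Real.sqrt n} ∪
      {ω : TableauPair n | (∀ x ∈ ω.1.youngDiagram.cells, (x.1 : ℝ) < 3 * Real.sqrt n ∧ (x.2 : ℝ) < 3 * Real.sqrt n) ∧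
          A * n * Real.sqrt n ≤ ∑ t ∈ Finset.range n, sqEnergy (shapeBefore (ω.2.2).1 t)} ∪
      {ω : TableauPair n | (∀ x ∈ ω.1.youngDiagram.cells, (x.1 : ℝ) < 3 * Real.sqrt n ∧ (x.2 : ℝ) < 3 * Real.sqrt n) ∧
          400 * (∑ t ∈ Finset.range n, ∑ z ∈ addableNodes (shapeBefore (ω.2.2).1 t),
            transProb (shapeBefore (ω.2.2).1 t) z * ((-1 : ℝ) ^ (z.1 + z.2) * (incr (shapeBefore (ω.2.2).1 t) z : ℝ))) ≤ -(n : ℝ)} := by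
    filter_upwards [fs_condExp_ae n] with ω hω hE
    obtain ⟨hrow, hcol, hJ⟩ := hE
    have hbox : ∀ x ∈ ω.1.youngDiagram.cells, (x.1 : ℝ) < 3 * Real.sqrt n ∧ (x.2 : ℝ) < 3 * Real.sqrt n :=
      box_of_rowLen_colLen _ _ hrow hcol
    have hboxt : ∀ t : ℕ, ∀ x ∈ shapeBefore (ω.2.2).1 t, (x.1 : ℝ) < 3 * Real.sqrt n ∧ (x.2 : ℝ) < 3 * Real.sqrt n :=
      fun t x hx => hbox x (fs_shapeBefore_subset_cells ω t hx)
    have hsumZ := fs_sum_Z_eq ω hbox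
    have hJr : ∑ t ∈ Finset.range n, ∑ z' ∈ shapeBefore (ω.2.2).1 (t + 1) \ shapeBefore (ω.2.2).1 t, (if (∀ x ∈ shapeBefore (ω.2.2).1 t, (x.1 : ℝ) < 3 * Real.sqrt n ∧ (x.2 : ℝ) < 3 * Real.sqrt n) then (-1 : ℝ) ^ (z'.1 + z'.2) * (incr (shapeBefore (ω.2.2).1 t) z' : ℝ) else 0) ≤ -((n : ℝ) / 200) := by
      rw [hsumZ]
      have hJ' := Int.cast_le (R := ℝ) |>.2 hJ
      push_cast at hJ' ⊢
      linarith
    have hcomp : ∑ t ∈ Finset.range n, ((pairMeasure n)[fun ω => ∑ z' ∈ shapeBefore (ω.2.2).1 (t + 1) \ shapeBefore (ω.2.2).1 t,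
          (if (∀ x ∈ shapeBefore (ω.2.2).1 t, (x.1 : ℝ) < 3 * Real.sqrt n ∧ (x.2 : ℝ) < 3 * Real.sqrt n) then (-1 : ℝ) ^ (z'.1 + z'.2) * (incr (shapeBefore (ω.2.2).1 t) z' : ℝ) else 0) | prefixFiltration n t]) ω =
        ∑ t ∈ Finset.range n, ∑ z ∈ addableNodes (shapeBefore (ω.2.2).1 t),
            transProb (shapeBefore (ω.2.2).1 t) z * ((-1 : ℝ) ^ (z.1 + z.2) * (incr (shapeBefore (ω.2.2).1 t) z : ℝ)) :=
      Finset.sum_congr rfl fun t ht => by rw [(hω t (Finset.mem_range.1 ht)).1, if_pos (hboxt t)]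
    have hqv : ∑ t ∈ Finset.range n, ((pairMeasure n)[fun ω' => (∑ z' ∈ shapeBefore (ω'.2.2).1 (t + 1) \ shapeBefore (ω'.2.2).1 t,
          (if (∀ x ∈ shapeBefore (ω'.2.2).1 t, (x.1 : ℝ) < 3 * Real.sqrt n ∧ (x.2 : ℝ) < 3 * Real.sqrt n) then (-1 : ℝ) ^ (z'.1 + z'.2) * (incr (shapeBefore (ω'.2.2).1 t) z' : ℝ) else 0)) ^ 2 | prefixFiltration n t]) ω =
        ∑ t ∈ Finset.range n, sqEnergy (shapeBefore (ω.2.2).1 t) :=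
      Finset.sum_congr rfl fun t ht => by rw [(hω t (Finset.mem_range.1 ht)).2, if_pos (hboxt t)]
    by_cases h3 : 400 * (∑ t ∈ Finset.range n, ∑ z ∈ addableNodes (shapeBefore (ω.2.2).1 t),
        transProb (shapeBefore (ω.2.2).1 t) z * ((-1 : ℝ) ^ (z.1 + z.2) * (incr (shapeBefore (ω.2.2).1 t) z : ℝ))) ≤ -(n : ℝ)
    · exact Or.inr ⟨hbox, h3⟩
    by_cases h2 : A * n * Real.sqrt n ≤ ∑ t ∈ Finset.range n, sqEnergy (shapeBefore (ω.2.2).1 t)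
    · exact Or.inl (Or.inr ⟨hbox, h2⟩)
    refine Or.inl (Or.inl ⟨?_, ?_⟩)
    · rw [Finset.sum_sub_distrib, hcomp]
      push Not at h3
      linarith
    · rw [hqv]
      exact (not_le.1 h2).le
  -- (3) the three bounds, as counts
  have hE2 := hQ n hn1 A hA0
  have hE3 := hMn n hn₀
  have hmeas := (fs_measureReal_mono_ae hincl).trans ((measureReal_union_le _ _).trans
    (add_le_add (measureReal_union_le _ _) le_rfl))
  rw [hbasic.2.1, hbasic.2.1 fun ω : TableauPair n =>
      (∀ x ∈ ω.1.youngDiagram.cells, (x.1 : ℝ) < 3 * Real.sqrt n ∧ (x.2 : ℝ) < 3 * Real.sqrt n) ∧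
        A * n * Real.sqrt n ≤ ∑ t ∈ Finset.range n, sqEnergy (shapeBefore (ω.2.2).1 t),
    hbasic.2.1 fun ω : TableauPair n =>
      (∀ x ∈ ω.1.youngDiagram.cells, (x.1 : ℝ) < 3 * Real.sqrt n ∧ (x.2 : ℝ) < 3 * Real.sqrt n) ∧
        400 * (∑ t ∈ Finset.range n, ∑ z ∈ addableNodes (shapeBefore (ω.2.2).1 t),
          transProb (shapeBefore (ω.2.2).1 t) z * ((-1 : ℝ) ^ (z.1 + z.2) * (incr (shapeBefore (ω.2.2).1 t) z : ℝ))) ≤ -(n : ℝ)] at hmeas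
  have hE2' := (div_le_iff₀' hfac).2 hE2
  have hE3' := (div_le_iff₀' hfac).2 hE3
  -- (4) exponent bookkeeping
  have hs := Real.sqrt_nonneg (n : ℝ)
  have he1 : Real.exp (-(1 / (640000 * A) * Real.sqrt n)) ≤ Real.exp (-(c' * Real.sqrt n)) :=
    Real.exp_le_exp.2 (by nlinarith)
  have he2 : Real.exp (-(κ * A * Real.sqrt n)) ≤ Real.exp (-(c' * Real.sqrt n)) :=
    Real.exp_le_exp.2 (by nlinarith)
  have he3 : Real.exp (-(cM * Real.sqrt n)) ≤ Real.exp (-(c' * Real.sqrt n)) :=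
    Real.exp_le_exp.2 (by nlinarith)
  have h4 := fs_four_exp_le hc' hn16
  have hsum := hmeas.trans (show _ ≤ 4 * Real.exp (-(c' * Real.sqrt n)) by linarith)
  rw [div_le_iff₀ hfac] at hsum
  nlinarith [hsum, h4, hfac]

end Summit.MatrixMultiplication.MatrixMultiplication.Theorems
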